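import Summits.AtomisticToContinuum.BoseEinsteinCondensation.Theses.BECSyncSkeleton

/-!
# `SkeletonCounting` (route BECSyncSkeleton, item stmt-AtomisticToContinuum-12373)

Pure bookkeeping: the engine `InhomogeneousRotorLRO` and the domination inequality
`SkeletonDomination` combine to `PeriodicCondensation`.  Given an admissible `v`, take `α_c` from
the engine and `g := α_c + 1`, obtaining `(c₀, K₀)`; put `η := min c₀ 1 / 4` and obtain `(A, ρ₀)`
from the domination; for `ρ < ρ₀` and eventually all `N` the domination supplies an even `K ≥ K₀`
and a skeleton whose side conditions are literally the engine's hypotheses; feed the engine's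
slack `δ_e` as `δr` to get `δ`; for a `δ`-near-minimiser `Ψ` the witness `Φ` is `δ_e`-near-minimal,
so `Σ cosCorrelation Φ ≥ c₀ K⁶`, whence `(1-η) c₀ N K³ ≤ K³ n₀(Ψ) + η N K³` and
`n₀(Ψ) ≥ ((1-η)c₀ - η) N ≥ (c₀/2) N`.
-/

namespace Summit.AtomisticToContinuum.BoseEinsteinCondensation.Theorems

open Summit.AtomisticToContinuum.BoseEinsteinCondensation.Theses.BECSyncSkeleton

/-- Arithmetic core of the counting: with `η := min c₀ 1 / 4` one has `η (c₀ + 1) ≤ c₀ / 2`. -/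
theorem skeletonCounting_eta_le (c₀ : ℝ) (hc₀ : 0 < c₀) :
    min c₀ 1 / 4 * (c₀ + 1) ≤ c₀ / 2 := by
  rcases le_total c₀ 1 with h | h
  · rw [min_eq_left h]
    nlinarith
  · rw [min_eq_right h]
    linarith

/-- Real-arithmetic step of the counting: from the domination inequality (in real form, after
`⊤` has been excluded and `K³` made explicit) and the engine's lower bound on the phase
coherences, the condensate occupation `r` is at least `(c₀/2) N`. -/
theorem skeletonCounting_real_step (c₀ η N K S r : ℝ) (hc₀ : 0 < c₀) (hη : η = min c₀ 1 / 4)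
    (hN : 0 ≤ N) (hK : 0 < K) (hcos : c₀ * K ^ 6 ≤ S)
    (hdom : (1 - η) * (N / K ^ 3) * S ≤ K ^ 3 * r + η * N * K ^ 3) :
    c₀ / 2 * N ≤ r := by
  have hηle : η * (c₀ + 1) ≤ c₀ / 2 := hη ▸ skeletonCounting_eta_le c₀ hc₀
  have hη1 : 0 ≤ 1 - η := by
    have : min c₀ 1 ≤ 1 := min_le_right _ _
    rw [hη]; linarith
  have hK3 : 0 < K ^ 3 := by positivity
  have h1 : (1 - η) * c₀ * N * K ^ 3 ≤ K ^ 3 * r + η * N * K ^ 3 := by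
    calc (1 - η) * c₀ * N * K ^ 3 = (1 - η) * (N / K ^ 3) * (c₀ * K ^ 6) := by
          field_simp
      _ ≤ (1 - η) * (N / K ^ 3) * S := by
          have : 0 ≤ (1 - η) * (N / K ^ 3) := by positivity
          exact mul_le_mul_of_nonneg_left hcos this
      _ ≤ K ^ 3 * r + η * N * K ^ 3 := hdom
  have h2 : (1 - η) * c₀ * N ≤ r + η * N := by
    have h1' : ((1 - η) * c₀ * N) * K ^ 3 ≤ (r + η * N) * K ^ 3 := by linarith
    exact le_of_mul_le_mul_right h1' hK3
  have hmul : η * (c₀ + 1) * N ≤ c₀ / 2 * N := mul_le_mul_of_nonneg_right hηle hN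
  nlinarith [h2, hmul]

/-- **SkeletonCounting** (support item stmt-AtomisticToContinuum-12373 of route BECSyncSkeleton):
`InhomogeneousRotorLRO → SkeletonDomination → PeriodicCondensation`, by bookkeeping only
(`g := α_c + 1`, `η := min c₀ 1 / 4`, `δr := δ_e`, `c := c₀ / 2`). -/
theorem skeletonCounting_proof : SkeletonCounting := by
  unfold SkeletonCounting
  intro hEng hDom v hv
  obtain ⟨αc, hαc, hEng⟩ := hEng
  obtain ⟨c₀, hc₀, K₀, hEng⟩ := hEng (αc + 1) (by linarith)
  have hηpos : 0 < min c₀ 1 / 4 := by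
    have : 0 < min c₀ 1 := lt_min hc₀ one_pos
    linarith
  obtain ⟨A, -, ρ₀, hρ₀, hDom⟩ := hDom v hv (αc + 1) (by linarith) (min c₀ 1 / 4) hηpos
  refine ⟨ρ₀, hρ₀, fun ρ hρ hρlt => ⟨c₀ / 2, by positivity, ?_⟩⟩
  filter_upwards [hDom ρ hρ hρlt K₀] with N hN
  obtain ⟨K, hKnz, hKeven, hK₀K, -, -, n, e, h, J, h₀, J₀, he, hh₀, hJ₀, hg, hhpos, hJsymm, hJnn,
    hhe, hJe, hrest⟩ := hN
  obtain ⟨δe, hδe, hE⟩ :=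
    @hEng K hKnz hKeven hK₀K n e he h J h₀ J₀ hh₀ hJ₀ hg hhpos hJsymm hJnn hhe hJe
  obtain ⟨δ, hδ, hD⟩ := hrest δe hδe
  refine ⟨δ, hδ, fun Ψ hΨ => ?_⟩
  obtain ⟨Φ, hΦmin, hΦdom⟩ := hD Ψ hΨ
  have hcos := hE Φ hΦmin
  -- ENNReal bookkeeping
  set n₀ := Literature.MathematicalPhysics.QuantumManyBody.BoseGas.condensateOccupation N
    (Literature.MathematicalPhysics.QuantumManyBody.BoseGas.sideLength ρ N) Ψ.ψ with hn₀
  rcases eq_or_ne n₀ ⊤ with htop | htop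
  · rw [htop]; exact le_top
  set S := ∑ x : Literature.Probability.LatticeModels.TorusSite 3 K,
    ∑ y : Literature.Probability.LatticeModels.TorusSite 3 K,
      Literature.MathematicalPhysics.QuantumLattice.QuantumRotor.cosCorrelation Φ (e x) (e y) with hS
  have hKpos : 0 < (K : ℝ) := by
    have := hKnz.out
    positivity
  have hN0 : 0 ≤ (N : ℝ) := Nat.cast_nonneg N
  have hr0 : 0 ≤ n₀.toReal := ENNReal.toReal_nonneg
  have hK3 : (K : ENNReal) ^ 3 = ENNReal.ofReal ((K : ℝ) ^ 3) := by
    rw [ENNReal.ofReal_pow (Nat.cast_nonneg K), ENNReal.ofReal_natCast]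
  have hηN : 0 ≤ min c₀ 1 / 4 * N * (K : ℝ) ^ 3 := by positivity
  rw [← ENNReal.ofReal_toReal htop, hK3, ← ENNReal.ofReal_mul (by positivity),
    ← ENNReal.ofReal_add (by positivity) hηN] at hΦdom
  have hdom := (ENNReal.ofReal_le_ofReal_iff (by positivity)).1 hΦdom
  rw [← ENNReal.ofReal_toReal htop]
  exact ENNReal.ofReal_le_ofReal
    (skeletonCounting_real_step c₀ (min c₀ 1 / 4) N K S n₀.toReal hc₀ rfl hN0 hKpos hcos hdom)

end Summit.AtomisticToContinuum.BoseEinsteinCondensation.Theorems
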